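import Summits.ABC.IUTFork.Cor312ThetaFinitePrVolM
import Summits.ABC.IUTFork.Cor312ThetaFiniteMSharp
import HarnessLib

/-!
# [IUTchIII] Corollary 3.12, statement — `ThetaFinite` AND `BridgeHyps` for the M-level SUMMAND-route setting at the SHARP
# Dupuy–Hilado binders read off Θ- and `q`-ideles of the genuine completions `K_{v̲}` — no Θ-box hypothesis left
# (G1-Θ unit P5, summand route, sharp instance; `HOME/staging/w5/w5-d166/g4/G1-THETA-SHAPES.md`, C-R12 (e) «target #2′»)

PROOF-ONLY record file (D-0012; no definitions, no `Prop` facts) of the abc-iut cell (R2 S-chain seat abc-iut-s2-p9,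
gen 0; branch C «abc ⇐ S»). TAKES NO SIDE on [IUTchIII] Cor. 3.12. Sequel of this seat's `Cor312ThetaFinitePrVolM`
(unit P5, summand route, generic Θ-boxes) and `Cor312ThetaFiniteMSharp` (p437661: the box conditions discharged for
abc-iut-w5-d166's sharp Θ-boxes `thetaBoxM t`). THIS file is the instance at abc-iut-w4-d013's summand-route setting
`Real.settingPrVolM` (`Cor312SettingPrVolM`, p435693) AT THE SHARP BINDERS of abc-iut-w5-d166's `Cor312SettingMSharp`
(p435453) — Θ-boxes `fun _ _ => thetaBoxM D hlog t`, `q`-centre `fun _ => qCentreM D hlog tq`, `hq := qCentreM_ne_zero`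
(`htq0`), `hfin` a binder (abc-iut-w4-d013's `qSupport_finite_PrVolM_sharp` / abc-iut-s2-p8's unit-P4 supplier inhabit it) —
i.e. the route on which abc-iut-c312-6's `BridgeHyps` is a theorem (abc-iut-w4-d013's `bridgeHyps_settingPrVolM`, needing
`hθ`, `hfinθ`, `ThetaFinite`), as abc-iut-c312-7's F-level capstone `Cor312PilotIdelesPrCapstone` (p424856):

* §1 `hullDefined_settingPrVolM_sharp` (every `(j, v_ℚ)`, from `ht0` alone), `thetaLocal_settingPrVolM_sharp_arc = 0`,
  `thetaLocal_settingPrVolM_sharp_eq_zero` (good `u`, unit Θ-ideles there), `thetaHull_settingPrVolM_sharp_eq_of_good`,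
  **`thetaFinite_settingPrVolM_sharp`** ("`−|log(Θ)| ∈ ℝ`" for Θ-ideles that are non-zero and units off a finite set `S_Θ` of
  rational places), `negLogTheta_settingPrVolM_sharp_ne_top`;
* §2 `thetaRegion3_settingPrVolM_sharp_non` (the (Ind3)-region at a finite place `= e⁻¹(Π_{v⃗} ι_j(t_{Θ,j,v̲_j})·(R_I)^∼)`),
  **`adm_thetaRegion3_settingPrVolM_sharp`** (`hθ`: admissible at every place — abc-iut-s2-p8's generic
  `adm_preimage_boxOf_sharpBox` at a finite place, the trivial container at `∞`), **`logvol_thetaRegion3_settingPrVolM_sharp_non`**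
  (`= Σ_{v⃗} Pr(v⃗)·log ‖t_{Θ,i+1,v̲_{i+1}}‖`, Dupuy–Hilado (3.7) summand by summand — the M-level twin of abc-iut-c312-7's
  `logvol_thetaRegion3_sharp_Pr_inr`), `logvol_thetaRegion3_settingPrVolM_sharp_arc = 0`,
  **`finite_support_logvol_thetaRegion3_settingPrVolM_sharp`** (`hfinθ`: support `⊆ S_Θ`), and
  **`bridgeHyps_settingPrVolM_sharp`** — abc-iut-c312-6's `BridgeHyps` for the summand-route M-level SHARP setting, the
  hypothesis `H : BridgeHyps P` of abc-iut-s2-p7's setting-side hull bound `thetaLocal_untopD_le_sum_of_stable_family`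
  (`Cor312ThetaLocalLeContentHull`, p437184) DISCHARGED at the M level (unit P6's instance then reads `hframe := rfl`,
  `hvol := SummandPieces.logvol_preimage_pi`).

[claim: Mochizuki2012, status: disputed] for the quoted setting; [cite: DupuyHilado2025, §3.6, §3.7, §3.9, §4.10];
[cite: Mochizuki2012, IUTchIV Thm 1.10 proof Step (vi) p. 29]. HONEST FRAMING: bookkeeping at the genuine carriers for idele
BINDERS `t`, `tq` (abc-iut-S2's genuine `I.tΘ`/`I.tq`, read by abc-iut-w5-d033's `tThetaM`/`tqM`, are instances); nothing
here bears on the truth of [IUTchIII] Cor. 3.12 (`Cor312.Setting.Statement` untouched); typed ≠ proved; instantiated ≠ endorsed.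
-/

noncomputable section

open Set Function NumberField IsDedekindDomain Bornology
open scoped Pointwise

namespace Summit.ABC.IUTFork.Thm311.Real

open Cor312 Cor312Vol Literature.IUT.LogThetaLattice Literature.IUT.LogVolume Literature.IUT.HodgeTheaters
  Literature.NumberTheory.NumberFields

variable {F K Fbar : Type} [Field F] [NumberField F] [Field K] [NumberField K] [Algebra F K]
  [Field Fbar] [Algebra F Fbar] [Algebra K Fbar] {E : WeierstrassCurve F} [E.IsElliptic] {l : ℕ}
  {Pb : BadPlacePredicates K} (D : InitialThetaData F K Fbar E l Pb) {logvK : PadicLogsVal K}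
  (hlog : LogvAnalyticVal logvK)

section Sharp

variable (M : Type) [Field M] [NumberField M]
  (archPk : ∀ (j : (thetaIndexOfInitial D).Label) (vQ : (thetaIndexOfInitial D).VQ),
    Set ((logShellsOfInitialDH D logvK).Packet j vQ))
  (archSub : ∀ (j : (thetaIndexOfInitial D).Label) (v : (thetaIndexOfInitial D).V),
    Set ((logShellsOfInitialDH D logvK).Packet j ((thetaIndexOfInitial D).over v)))
  (Ψ : ℤ → ∀ v : (thetaIndexOfInitial D).V, v ∈ (thetaIndexOfInitial D).Vbad →
    Set ((logShellsOfInitialDH D logvK).StarPacket v))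
  (act : ℤ → ∀ v : (thetaIndexOfInitial D).V, v ∈ (thetaIndexOfInitial D).Vbad →
    (logShellsOfInitialDH D logvK).StarPacket v → Module.End ℚ ((logShellsOfInitialDH D logvK).StarPacket v))
  (Mmod : ℤ → ∀ j : (thetaIndexOfInitial D).LabelStar, Set ((logShellsOfInitialDH D logvK).GlobalPacket j.1))
  (region : ℤ → ∀ j : (thetaIndexOfInitial D).LabelStar, FinDivisor M → ∀ vQ : (thetaIndexOfInitial D).VQ,
    Set ((logShellsOfInitialDH D logvK).Packet j.1 vQ))
  (n : ℤ) {HT : Type} {LogLink : HT → HT → Type} {IsFull : ∀ {s t : HT}, LogLink s t → Prop}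
  (lat : LGPGaussianLogThetaLattice LogLink IsFull)
  {Frd : Type} {IsoF : Frd → Frd → Type} {Ob : Frd → Type} {realify : Frd → Frd} {Strip : Type}
  {IsoS : Strip → Strip → Type} {Mv : ∀ v : (thetaIndexOfInitial D).V, v ∈ (thetaIndexOfInitial D).Vbad → Type}
  [∀ v h, Monoid (Mv v h)]
  (sig : GlobalLGPFrobenioidSignature (thetaIndexOfInitial D).lstar (thetaIndexOfInitial D).V
    (· ∈ (thetaIndexOfInitial D).Vbad) Frd IsoF Ob realify Strip IsoS Mv)
  (split : SplittingMonoids Mv) {ObΔ : Type} {N : ∀ v : (thetaIndexOfInitial D).V, v ∈ (thetaIndexOfInitial D).Vbad → Type}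
  [∀ v h, Monoid (N v h)] (qData : QPilotData ObΔ N)
  (t : ∀ (u : FinitePlace ℚ) (_ : Fin (thetaIndexOfInitial D).lstar) (x : (thetaIndexOfInitial D).Fibre (Val.non u)),
    kOfM D (ratChar u) u (natCast_ratChar_mem u) x)
  (tq : ∀ (u : FinitePlace ℚ) (x : (thetaIndexOfInitial D).Fibre (Val.non u)),
    kOfM D (ratChar u) u (natCast_ratChar_mem u) x)
  (htq0 : ∀ u x, tq u x ≠ 0)
  (hfin : ∀ j : (thetaIndexOfInitial D).Label, (Function.support fun vQ =>
    ((situationPrVolM D hlog M archPk archSub Ψ act Mmod region).D n).logvol j vQ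
      (factorMapM D hlog j vQ ⁻¹' hullSet (factorFieldM D hlog j vQ)
        ((fun _ : ObΔ => qCentreM D hlog tq) (qPilotObject qData) j vQ))).Finite)
  (ht0 : ∀ u i x, t u i x ≠ 0)

/-! ## §1. `HullDefined`, arch-zero, good-place-zero, `ThetaFinite` at the sharp binders -/

include ht0 in
/-- **`HullDefined` at EVERY `(j, v_ℚ)` for the summand-route M-level setting at the sharp binders** (non-zero Θ-ideles: the sharp
Θ-boxes are hull-sets, bounded and nondegenerate). [claim: Mochizuki2012, status: disputed] -/
theorem hullDefined_settingPrVolM_sharp (j : (thetaIndexOfInitial D).Label) (vQ : (thetaIndexOfInitial D).VQ) :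
    (settingPrVolM D hlog M archPk archSub Ψ act Mmod region n lat sig split qData (fun _ _ => thetaBoxM D hlog t)
      (fun _ => qCentreM D hlog tq) (qCentreM_ne_zero D hlog tq htq0) hfin).HullDefined j vQ :=
  hullDefined_settingPrVolM D hlog M archPk archSub Ψ act Mmod region n lat sig split qData (fun _ _ => thetaBoxM D hlog t)
    (fun _ => qCentreM D hlog tq) (qCentreM_ne_zero D hlog tq htq0) hfin j
    (fun u => isBounded_iUnion_thetaBoxM_non D hlog t ht0 j u)
    (fun u => isNondegenerate_iUnion_thetaBoxM_non D hlog t ht0 j u) vQ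

include ht0 in
/-- The local Θ-volume at the sharp binders is a real number at every `(j, v_ℚ)`. [claim: Mochizuki2012, status: disputed] -/
theorem thetaLocal_ne_top_settingPrVolM_sharp (j : (thetaIndexOfInitial D).Label) (vQ : (thetaIndexOfInitial D).VQ) :
    (settingPrVolM D hlog M archPk archSub Ψ act Mmod region n lat sig split qData (fun _ _ => thetaBoxM D hlog t)
      (fun _ => qCentreM D hlog tq) (qCentreM_ne_zero D hlog tq htq0) hfin).thetaLocal j vQ ≠ ⊤ := by
  unfold Setting.thetaLocal
  rw [if_pos (hullDefined_settingPrVolM_sharp D hlog M archPk archSub Ψ act Mmod region n lat sig split qData t tq htq0 hfin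
    ht0 j vQ)]
  exact WithTop.coe_ne_top

/-- **The ARCHIMEDEAN local Θ-volume at the sharp binders is `0`** (trivial archimedean container; SHAPES unit (A)).
[claim: Mochizuki2012, status: disputed] -/
theorem thetaLocal_settingPrVolM_sharp_arc (j : (thetaIndexOfInitial D).Label) (w : InfinitePlace ℚ) :
    (settingPrVolM D hlog M archPk archSub Ψ act Mmod region n lat sig split qData (fun _ _ => thetaBoxM D hlog t)
      (fun _ => qCentreM D hlog tq) (qCentreM_ne_zero D hlog tq htq0) hfin).thetaLocal j (Val.arc w) = ((0 : ℝ) : WithTop ℝ) :=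
  thetaLocal_settingPrVolM_arc D hlog M archPk archSub Ψ act Mmod region n lat sig split qData (fun _ _ => thetaBoxM D hlog t)
    (fun _ => qCentreM D hlog tq) (qCentreM_ne_zero D hlog tq htq0) hfin j w

include ht0 in
/-- **At a GOOD finite place where the Θ-ideles of the label are units, the local Θ-volume at the sharp binders is `0`**
(`p_u > 2`, `p_u ∤ disc(K)`; [IUTchIV] Thm. 1.10 Step (vi)). [cite: Mochizuki2012, IUTchIV Thm 1.10 proof Step (vi) p. 29] -/
theorem thetaLocal_settingPrVolM_sharp_eq_zero (i : Fin (thetaIndexOfInitial D).lstar) (u : FinitePlace ℚ)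
    (hp2 : 2 < ratChar u) (hdisc : ¬ ((ratChar u : ℕ) : ℤ) ∣ NumberField.discr K)
    (h1 : ∀ x : (thetaIndexOfInitial D).Fibre (Val.non u), ‖t u i x‖ = 1) :
    (settingPrVolM D hlog M archPk archSub Ψ act Mmod region n lat sig split qData (fun _ _ => thetaBoxM D hlog t)
      (fun _ => qCentreM D hlog tq) (qCentreM_ne_zero D hlog tq htq0) hfin).thetaLocal (Setting.labelSucc i) (Val.non u) =
        ((0 : ℝ) : WithTop ℝ) :=
  thetaLocal_settingPrVolM_eq_zero D hlog M archPk archSub Ψ act Mmod region n lat sig split qData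
    (fun _ _ => thetaBoxM D hlog t) (fun _ => qCentreM D hlog tq) (qCentreM_ne_zero D hlog tq htq0) hfin i u hp2 hdisc
    (by rw [iUnion_thetaBoxM]; exact thetaBoxM_labelSucc_eq_hullSet_one D hlog t ht0 i u h1)

include ht0 in
/-- At a good finite place where the Θ-ideles of the label are units, the hull of the union of ALL possible images at the sharp
binders IS `e⁻¹(Π_{v⃗} (R_{v⃗})^∼)`. [cite: Mochizuki2012, IUTchIV Thm 1.10 proof Step (vi) p. 29] -/
theorem thetaHull_settingPrVolM_sharp_eq_of_good (i : Fin (thetaIndexOfInitial D).lstar) (u : FinitePlace ℚ)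
    (hp2 : 2 < ratChar u) (hdisc : ¬ ((ratChar u : ℕ) : ℤ) ∣ NumberField.discr K)
    (h1 : ∀ x : (thetaIndexOfInitial D).Fibre (Val.non u), ‖t u i x‖ = 1) :
    (settingPrVolM D hlog M archPk archSub Ψ act Mmod region n lat sig split qData (fun _ _ => thetaBoxM D hlog t)
      (fun _ => qCentreM D hlog tq) (qCentreM_ne_zero D hlog tq htq0) hfin).thetaHull (Setting.labelSucc i) (Val.non u) =
        (presAtM D hlog u).latticePk (Setting.labelSucc i) 1 :=
  thetaHull_ofFramesM_eq_of_good D hlog M archPk archSub (summandPiecesPrM D hlog).Adm (summandPiecesPrM D hlog).logvol Ψ act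
    Mmod region n lat sig split qData (fun _ _ => thetaBoxM D hlog t) (fun _ => qCentreM D hlog tq)
    (qCentreM_ne_zero D hlog tq htq0) (hadm_PrM D hlog M archPk archSub Ψ act Mmod region n) hfin i u hp2 hdisc
    (by rw [iUnion_thetaBoxM]; exact thetaBoxM_labelSucc_eq_hullSet_one D hlog t ht0 i u h1)

variable
  /- the Θ-ideles are units off a finite set of rational places (e.g. those under `𝕍^bad_mod`) -/
  (Sθ : Finset (FinitePlace ℚ))
  (ht1 : ∀ (u : FinitePlace ℚ) (i : Fin (thetaIndexOfInitial D).lstar) (x : (thetaIndexOfInitial D).Fibre (Val.non u)),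
    u ∉ Sθ → ‖t u i x‖ = 1)

include ht0 ht1 in
/-- **`ThetaFinite` ("`−|log(Θ)| ∈ ℝ`", the first clause of [IUTchIII] Cor. 3.12) for the summand-route M-LEVEL setting at the
sharp binders**, for non-zero Θ-ideles that are units off a finite set `S_Θ` of rational places — the M-level twin, on the route of
record, of abc-iut-c312-7's `thetaFinite_settingPrVolSharp` (p424856). [claim: Mochizuki2012, status: disputed] -/
theorem thetaFinite_settingPrVolM_sharp :
    (settingPrVolM D hlog M archPk archSub Ψ act Mmod region n lat sig split qData (fun _ _ => thetaBoxM D hlog t)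
      (fun _ => qCentreM D hlog tq) (qCentreM_ne_zero D hlog tq htq0) hfin).ThetaFinite :=
  thetaFinite_settingPrVolM D hlog M archPk archSub Ψ act Mmod region n lat sig split qData (fun _ _ => thetaBoxM D hlog t)
    (fun _ => qCentreM D hlog tq) (qCentreM_ne_zero D hlog tq htq0) hfin
    (fun i u => isBounded_iUnion_thetaBoxM_non D hlog t ht0 (Setting.labelSucc i) u)
    (fun i u => isNondegenerate_iUnion_thetaBoxM_non D hlog t ht0 (Setting.labelSucc i) u)
    (fun i => Sθ.finite_toSet.subset fun u hu => by
      by_contra hS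
      exact hu (by rw [iUnion_thetaBoxM]; exact thetaBoxM_labelSucc_eq_hullSet_one D hlog t ht0 i u fun x => ht1 u i x hS))

include ht0 ht1 in
/-- Hence `−|log(Θ)| ≠ +∞` at the sharp binders on the summand route. [claim: Mochizuki2012, status: disputed] -/
theorem negLogTheta_settingPrVolM_sharp_ne_top :
    (settingPrVolM D hlog M archPk archSub Ψ act Mmod region n lat sig split qData (fun _ _ => thetaBoxM D hlog t)
      (fun _ => qCentreM D hlog tq) (qCentreM_ne_zero D hlog tq htq0) hfin).negLogTheta ≠ ⊤ := by
  unfold Setting.negLogTheta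
  rw [if_pos (thetaFinite_settingPrVolM_sharp D hlog M archPk archSub Ψ act Mmod region n lat sig split qData t tq htq0 hfin
    ht0 Sθ ht1)]
  exact WithTop.coe_ne_top

/-! ## §2. The (Ind3)-region at the sharp binders: admissible, closed-form volume, finite support; `BridgeHyps` -/

/-- The (Ind3)-enlarged Θ-region at the sharp binders is the preimage under `factorMapM` of the (constant union of the) sharp
Θ-boxes. [cite: DupuyHilado2025, §4.10] -/
theorem thetaRegion3_settingPrVolM_sharp (j : (thetaIndexOfInitial D).Label) (vQ : (thetaIndexOfInitial D).VQ) :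
    (settingPrVolM D hlog M archPk archSub Ψ act Mmod region n lat sig split qData (fun _ _ => thetaBoxM D hlog t)
      (fun _ => qCentreM D hlog tq) (qCentreM_ne_zero D hlog tq htq0) hfin).thetaRegion3 j vQ =
      factorMapM D hlog j vQ ⁻¹' ⋃ _m : ℤ, thetaBoxM D hlog t j vQ := by
  rw [Set.preimage_iUnion]
  rfl

/-- At a finite place the (Ind3)-enlarged Θ-region at the sharp binders is `e⁻¹(Π_{v⃗} ι_j(t_{Θ,j,v̲_j})·(R_I)^∼)` (the box of
abc-iut-s2-p8's generic sharp regions of `presAtM D hlog u`; Dupuy–Hilado §3.9, §4.10). [cite: DupuyHilado2025, §3.9, §4.10] -/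
theorem thetaRegion3_settingPrVolM_sharp_non (j : (thetaIndexOfInitial D).Label) (u : FinitePlace ℚ) :
    (settingPrVolM D hlog M archPk archSub Ψ act Mmod region n lat sig split qData (fun _ _ => thetaBoxM D hlog t)
      (fun _ => qCentreM D hlog tq) (qCentreM_ne_zero D hlog tq htq0) hfin).thetaRegion3 j (Val.non u) =
      (presAtM D hlog u).comparison j ⁻¹' Set.pi univ ((presAtM D hlog u).sharpBox (t u) j) := by
  rw [thetaRegion3_settingPrVolM_sharp D hlog M archPk archSub Ψ act Mmod region n lat sig split qData t tq htq0 hfin j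
    (Val.non u), iUnion_thetaBoxM]
  exact (presAtM D hlog u).factorMap_preimage_boxOf_sharpBox (t u) j

/-- `hθ` at the archimedean place: the (Ind3)-region at the sharp binders (the whole packet) is admissible in the trivial
archimedean container. [claim: Mochizuki2012, status: disputed] -/
theorem adm_thetaRegion3_settingPrVolM_sharp_arc (j : (thetaIndexOfInitial D).Label) (w : InfinitePlace ℚ) :
    ((situationPrVolM D hlog M archPk archSub Ψ act Mmod region).D n).Adm j (Val.arc w)
      ((settingPrVolM D hlog M archPk archSub Ψ act Mmod region n lat sig split qData (fun _ _ => thetaBoxM D hlog t)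
        (fun _ => qCentreM D hlog tq) (qCentreM_ne_zero D hlog tq htq0) hfin).thetaRegion3 j (Val.arc w)) := by
  refine (LocalPieces.adm_trivial_iff (logShellsOfInitialDH D logvK) (Val.arc w) j _).2 ⟨0, ?_⟩
  rw [thetaRegion3_settingPrVolM_sharp D hlog M archPk archSub Ψ act Mmod region n lat sig split qData t tq htq0 hfin j
    (Val.arc w), Set.mem_preimage, Set.mem_iUnion]
  exact ⟨0, Set.mem_univ _⟩

include ht0 in
/-- **`hθ` at a finite place: the (Ind3)-region at the sharp binders is ADMISSIBLE** in the M-level probability-weighted verbatim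
container (a direct product of nondegenerate translates of `(R_I)^∼`, abc-iut-s2-p8's `adm_preimage_boxOf_sharpBox` pattern).
[claim: Mochizuki2012, status: disputed] -/
theorem adm_thetaRegion3_settingPrVolM_sharp_non (j : (thetaIndexOfInitial D).Label) (u : FinitePlace ℚ) :
    ((situationPrVolM D hlog M archPk archSub Ψ act Mmod region).D n).Adm j (Val.non u)
      ((settingPrVolM D hlog M archPk archSub Ψ act Mmod region n lat sig split qData (fun _ _ => thetaBoxM D hlog t)
        (fun _ => qCentreM D hlog tq) (qCentreM_ne_zero D hlog tq htq0) hfin).thetaRegion3 j (Val.non u)) := by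
  rw [thetaRegion3_settingPrVolM_sharp D hlog M archPk archSub Ψ act Mmod region n lat sig split qData t tq htq0 hfin j
    (Val.non u), iUnion_thetaBoxM]
  exact (presAtM D hlog u).adm_preimage_boxOf ((presAtM D hlog u).packetAdm_sharpBox (t u) (ht0 u) j)

include ht0 in
/-- **`hθ` PROVED: the (Ind3)-region at the sharp binders is ADMISSIBLE at every `(j, v_ℚ)`.**
[claim: Mochizuki2012, status: disputed] -/
theorem adm_thetaRegion3_settingPrVolM_sharp (j : (thetaIndexOfInitial D).Label) (vQ : (thetaIndexOfInitial D).VQ) :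
    ((situationPrVolM D hlog M archPk archSub Ψ act Mmod region).D n).Adm j vQ
      ((settingPrVolM D hlog M archPk archSub Ψ act Mmod region n lat sig split qData (fun _ _ => thetaBoxM D hlog t)
        (fun _ => qCentreM D hlog tq) (qCentreM_ne_zero D hlog tq htq0) hfin).thetaRegion3 j vQ) := by
  rcases vQ with w | u
  · exact adm_thetaRegion3_settingPrVolM_sharp_arc D hlog M archPk archSub Ψ act Mmod region n lat sig split qData t tq htq0
      hfin j w
  · exact adm_thetaRegion3_settingPrVolM_sharp_non D hlog M archPk archSub Ψ act Mmod region n lat sig split qData t tq htq0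
      hfin ht0 j u

include ht0 in
/-- **The log-volume of the (Ind3)-region at the sharp binders at `(i+1, u)`, in CLOSED FORM**:
`Σ_{v⃗} Pr(v⃗)·log ‖t_{Θ,i+1,v̲_{i+1}}‖` (Dupuy–Hilado (3.7) summand by summand, probability weights of `V_mod`; the M-level twin
of abc-iut-c312-7's `logvol_thetaRegion3_sharp_Pr_inr`). [cite: DupuyHilado2025, §3.6, §3.7, §3.9] -/
theorem logvol_thetaRegion3_settingPrVolM_sharp_non (i : Fin (thetaIndexOfInitial D).lstar) (u : FinitePlace ℚ) :
    ((situationPrVolM D hlog M archPk archSub Ψ act Mmod region).D n).logvol (Setting.labelSucc i) (Val.non u)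
      ((settingPrVolM D hlog M archPk archSub Ψ act Mmod region n lat sig split qData (fun _ _ => thetaBoxM D hlog t)
        (fun _ => qCentreM D hlog tq) (qCentreM_ne_zero D hlog tq htq0) hfin).thetaRegion3 (Setting.labelSucc i) (Val.non u)) =
      ∑ e : (presAtM D hlog u).toLocalPieces.E (Setting.labelSucc i),
        weightM D u (Setting.labelSucc i) e * Real.log ‖t u i (e (Fin.last _))‖ := by
  rw [thetaRegion3_settingPrVolM_sharp_non D hlog M archPk archSub Ψ act Mmod region n lat sig split qData t tq htq0 hfin _ u]
  refine ((realizes_situationPrVolM D hlog M archPk archSub Ψ act Mmod region n).logvol_eq _ (Val.non u) _).trans ?_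
  refine (SummandPieces.logvol_preimage_pi (summandPiecesPrM D hlog) (Setting.labelSucc i) (Val.non u)
    (R := (presAtM D hlog u).sharpBox (t u) (Setting.labelSucc i))
    (fun e => (presAtM D hlog u).packetAdm_sharpBox (t u) (ht0 u) _ e)).trans ?_
  refine Finset.sum_congr rfl fun e _ => ?_
  show weightM D u (Setting.labelSucc i) e *
      packetLogμ (ratChar u) ((presAtM D hlog u).kk e) ((presAtM D hlog u).sharpBox (t u) (Setting.labelSucc i) e) = _
  exact congrArg (weightM D u (Setting.labelSucc i) e * ·)
    ((presAtM D hlog u).packetLogμ_sharpBox_labelSucc (t u) (ht0 u) i e)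

/-- At the archimedean place the log-volume of the (Ind3)-region at the sharp binders is `0` (trivial container).
[folklore] -/
theorem logvol_thetaRegion3_settingPrVolM_sharp_arc (j : (thetaIndexOfInitial D).Label) (w : InfinitePlace ℚ) :
    ((situationPrVolM D hlog M archPk archSub Ψ act Mmod region).D n).logvol j (Val.arc w)
      ((settingPrVolM D hlog M archPk archSub Ψ act Mmod region n lat sig split qData (fun _ _ => thetaBoxM D hlog t)
        (fun _ => qCentreM D hlog tq) (qCentreM_ne_zero D hlog tq htq0) hfin).thetaRegion3 j (Val.arc w)) = 0 :=
  logvol_summandPiecesPrM_arc D hlog j w _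

include ht0 ht1 in
/-- **`hfinθ` PROVED: the log-volumes of the (Ind3)-region at the sharp binders are finitely supported over `V_ℚ`** at every label
`j = i+1` (support `⊆ S_Θ`: units off `S_Θ`, `0` at `∞`; [IUTchIII] Prop. 3.9 (iii)). [claim: Mochizuki2012, status: disputed] -/
theorem finite_support_logvol_thetaRegion3_settingPrVolM_sharp (i : Fin (thetaIndexOfInitial D).lstar) :
    (Function.support fun vQ : (thetaIndexOfInitial D).VQ =>
      ((situationPrVolM D hlog M archPk archSub Ψ act Mmod region).D n).logvol (Setting.labelSucc i) vQ
        ((settingPrVolM D hlog M archPk archSub Ψ act Mmod region n lat sig split qData (fun _ _ => thetaBoxM D hlog t)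
          (fun _ => qCentreM D hlog tq) (qCentreM_ne_zero D hlog tq htq0) hfin).thetaRegion3 (Setting.labelSucc i) vQ)).Finite := by
  refine (Sθ.finite_toSet.image Val.non).subset fun vQ hvQ => ?_
  rcases vQ with w | u
  · exact absurd (logvol_thetaRegion3_settingPrVolM_sharp_arc D hlog M archPk archSub Ψ act Mmod region n lat sig split qData
      t tq htq0 hfin _ w) hvQ
  · refine ⟨u, ?_, rfl⟩
    by_contra hS
    have h0 : ((situationPrVolM D hlog M archPk archSub Ψ act Mmod region).D n).logvol (Setting.labelSucc i) (Val.non u)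
        ((settingPrVolM D hlog M archPk archSub Ψ act Mmod region n lat sig split qData (fun _ _ => thetaBoxM D hlog t)
          (fun _ => qCentreM D hlog tq) (qCentreM_ne_zero D hlog tq htq0) hfin).thetaRegion3 (Setting.labelSucc i)
          (Val.non u)) = 0 := by
      rw [logvol_thetaRegion3_settingPrVolM_sharp_non D hlog M archPk archSub Ψ act Mmod region n lat sig split qData t tq htq0
        hfin ht0 i u]
      exact Finset.sum_eq_zero fun e _ => by rw [ht1 u i _ hS, Real.log_one, mul_zero]
    exact absurd h0 hvQ

include ht0 ht1 in
/-- **abc-iut-c312-6's `BridgeHyps` for the summand-route M-LEVEL setting at the SHARP binders** (`mono`, `image_adm`,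
`image_fin`, `hul_nonempty`, `theta_nonempty` by abc-iut-w4-d013's `bridgeHyps_settingPrVolM`; `hθ`, `hfinθ`, `ThetaFinite`
DISCHARGED here) — the hypothesis `H : BridgeHyps P` of abc-iut-s2-p7's setting-side hull bound (p437184), at the M level, for
non-zero Θ-ideles that are units off `S_Θ`. The M-level twin of abc-iut-c312-7's `bridgeHyps_settingPrVolSharp_of_ideles`.
[claim: Mochizuki2012, status: disputed] -/
theorem bridgeHyps_settingPrVolM_sharp :
    BridgeHyps (settingPrVolM D hlog M archPk archSub Ψ act Mmod region n lat sig split qData (fun _ _ => thetaBoxM D hlog t)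
      (fun _ => qCentreM D hlog tq) (qCentreM_ne_zero D hlog tq htq0) hfin) :=
  bridgeHyps_settingPrVolM D hlog M archPk archSub Ψ act Mmod region n lat sig split qData (fun _ _ => thetaBoxM D hlog t)
    (fun _ => qCentreM D hlog tq) (qCentreM_ne_zero D hlog tq htq0) hfin
    (fun i vQ => adm_thetaRegion3_settingPrVolM_sharp D hlog M archPk archSub Ψ act Mmod region n lat sig split qData t tq htq0
      hfin ht0 (Setting.labelSucc i) vQ)
    (fun i => finite_support_logvol_thetaRegion3_settingPrVolM_sharp D hlog M archPk archSub Ψ act Mmod region n lat sig split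
      qData t tq htq0 hfin ht0 Sθ ht1 i)
    (thetaFinite_settingPrVolM_sharp D hlog M archPk archSub Ψ act Mmod region n lat sig split qData t tq htq0 hfin ht0 Sθ ht1)

end Sharp

end Summit.ABC.IUTFork.Thm311.Real

end
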